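import Summits.HodgeConjecture.HodgeConjecture.Theses.HolomorphicityRate
import Literature.AlgebraicGeometry.HodgeTheory.ComplexGysin
import Literature.Geometry.Kaehler.NearlyHolomorphicCycleSupport

/-!
# Route HolomorphicityRate — objects the route posits (definitions)

§1 `TiltInequality μ` — the **tilt inequality for nearly holomorphic cycle supports**, the
geometric-measure-theoretic half of the support item `ThresholdForcesHodgeType`
(stmt-HodgeConjecture-10764), isolated by the reduction theorem
`Theorems.thresholdForcesHodgeType_of_tilt` (file `HolomorphicityRateThresholdForcesHodgeTypeOfTilt`),
whose hypothesis `htilt` it is VERBATIM: for `X` smooth projective of dimension `n`, `0 < p < n`, a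
Hodge model `A`, a smooth Riemannian metric `g` on `X^an` and a class `b ∈ Hᵈ(X(ℂ); ℂ)`,
`2p + d = 2n`, of pure type `(p', q')` in `A` which is NOT complementary to `(p, p)`, there are a
class `η ∈ Hᵈ(X(ℂ); ℂ)` and constants `K`, `t₀ > 0` such that every class `γ ∈ H²ᵖ(X(ℂ); ℂ)` whose
pull-back to `X^an` dies off a nearly holomorphic cycle support `S` of defect `|t| ≤ t₀`
(`Literature.Geometry.Kaehler.IsNearlyHolomorphicCycleSupport g.toRiemannianMetric p t S Sg`)
satisfies `‖⟨γ ∪ b, [X(ℂ)]_μ⟩‖ ≤ K · |t| · ‖⟨γ ∪ η, [X(ℂ)]_μ⟩‖` (pairings `cupPairing (μ hX)` for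
the orientation family `μ`).

Status. NOT a result of the literature and not a route item: a route-posited statement, recorded
here so that the census of the item and its reduction can name it
(`thresholdForcesHodgeType_of_tilt μ hG (h : TiltInequality μ)`). Why it is expected to hold
(intended `η = [ω^{n-p}]`, `ω` a Kähler form of `X^an`): (T1) the classes dying off `S` form a line
`ℂ · [S]` (`Hʲ(M, M ∖ Sg) = 0` for `j ≤ 2p + 1` as `Sg` lies in an analytic set of real dimension
`≤ 2n - 2p - 2`; Thom isomorphism for the connected `C¹` submanifold `S ∖ Sg` of `M ∖ Sg`); (T2) `[S]`
is the closed current of integration over `S ∖ Sg` (finite mass by analyticity near `Sg`, Lelong;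
closed across `Sg` by `𝓗^{2n-2p-1}(Sg) = 0`, Federer 4.1.20), so `⟨γ ∪ e[ψ], [X]⟩ = c λ ∫_{S∖Sg} ψ`;
(T3) pointwise, an off-type `(p', q')`-form restricted to a `t`-nearly complex `2(n-p)`-plane is
`O(t)` times the volume form (tree: `Literature.Geometry.Kaehler.norm_apply_le_of_defect_of_weight`,
`NearlyComplexPlanesOffType`; at `t = 0`, `IsOfType.apply_eq_zero_of_forall_mem`,
`ComplexFormsMixedType`) while `ω^{n-p}/(n-p)!` restricts to `(1 - O(t))` times the volume form
(Wirtinger with defect); (T4) integrate and compare: `|⟨γ ∪ b⟩| ≤ C_b |t| · |λ| Mass(S)` and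
`|⟨γ ∪ η⟩| ≥ (n-p)! (1 - C t₀) |c λ| Mass(S)`, metrics on the compact `X^an` being comparable. Steps
(T1), (T2), (T4) need integration currents of `C¹` submanifolds and the Thom class on manifolds,
which the tree does not have yet (its geometric measure theory is Euclidean).
[cite: HarveyLawson1982, §II.1] [cite: King1971] [cite: Federer1969, 4.1.20]
-/

noncomputable section

-- `Summit.HodgeConjecture.HodgeConjecture.Theorems` is the mandated namespace (single-problem summit:
-- Problem = Summit), which `linter.dupNamespace` flags on every declaration; the lakefile turns the
-- linter off tree-wide (weak option), restated here so stand-alone elaboration is warning-free too.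
set_option linter.dupNamespace false

namespace Summit.HodgeConjecture.HodgeConjecture.Theorems.HolomorphicityRate

open scoped Manifold ContDiff Topology
open Literature.AlgebraicGeometry.HodgeTheory Literature.AlgebraicGeometry.Motives
  Literature.AlgebraicTopology.SingularHomology Literature.Geometry.Kaehler

/-! ### §1 The tilt inequality -/

/-- **The tilt inequality for nearly holomorphic cycle supports** (relative to the orientation
family `μ`), in the middle range `0 < p < n`: for `X` smooth projective of dimension `n`, a Hodge
model `A`, a smooth metric `g`, `2p + d = 2n` and a class `b ∈ Hᵈ(X(ℂ); ℂ)` of pure type `(p', q')`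
in `A` not complementary to `(p, p)` (`¬ (p + p' = n ∧ p + q' = n)`), there are `η ∈ Hᵈ(X(ℂ); ℂ)`
and `K`, `t₀ > 0` such that for every `t` with `|t| ≤ t₀`, every nearly holomorphic cycle support
`(S, Sg)` of codimension `p` and defect `≤ t` for `g`, and every class `γ ∈ H²ᵖ(X(ℂ); ℂ)` whose
pull-back to `X^an` restricts to `0` on `X^an ∖ S`:
`‖⟨γ ∪ b, [X(ℂ)]_μ⟩‖ ≤ K |t| ‖⟨γ ∪ η, [X(ℂ)]_μ⟩‖`. Verbatim the hypothesis `htilt` of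
`Theorems.thresholdForcesHodgeType_of_tilt`, which derives the route item `ThresholdForcesHodgeType`
from it (and the named fact `Grothendieck1969_supportedClasses_le_hodgeConiveau`). Route-posited;
not a result of the literature (see the module docstring for why it is expected and what its
proof needs). [cite: HarveyLawson1982, §II.1] [cite: King1971] -/
def TiltInequality (μ : OrientationFamily) : Prop :=
  ∀ ⦃n p : ℕ⦄ ⦃X : SchemeOver ℂ⦄ (hX : IsSmoothProjective n X), 0 < p → p < n →
    ∀ (A : HodgeModel n X)
      (g : Bundle.ContMDiffRiemannianMetric 𝓘(ℝ, A.model) ((⊤ : ℕ∞) : WithTop ℕ∞) A.model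
        (fun x : A.carrier => TangentSpace 𝓘(ℝ, A.model) x))
      (d : ℕ) (hd : 2 * p + d = 2 * n) (p' q' : ℕ) (b : complexBetti X d),
      ¬ (p + p' = n ∧ p + q' = n) → A.pullback d b ∈ A.hodgePQ d p' q' →
      ∃ (η : complexBetti X d) (K t₀ : ℝ), 0 < t₀ ∧
        ∀ (t : ℝ) (S Sg : Set A.carrier) (γ : complexBetti X (2 * p)), |t| ≤ t₀ →
          IsNearlyHolomorphicCycleSupport g.toRiemannianMetric p t S Sg →
          singularCohomology.map ℂ ℂ
            (⟨Subtype.val, continuous_subtype_val⟩ : C({x : A.carrier // x ∉ S}, A.carrier))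
            (2 * p) (A.pullback (2 * p) γ) = 0 →
          ‖cupPairing (μ hX) hd γ b‖ ≤ K * |t| * ‖cupPairing (μ hX) hd γ η‖

/-- Unfolding of `TiltInequality` (its body, for rewriting). [folklore] -/
theorem tiltInequality_iff (μ : OrientationFamily) :
    TiltInequality μ ↔
      ∀ ⦃n p : ℕ⦄ ⦃X : SchemeOver ℂ⦄ (hX : IsSmoothProjective n X), 0 < p → p < n →
        ∀ (A : HodgeModel n X)
          (g : Bundle.ContMDiffRiemannianMetric 𝓘(ℝ, A.model) ((⊤ : ℕ∞) : WithTop ℕ∞) A.model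
            (fun x : A.carrier => TangentSpace 𝓘(ℝ, A.model) x))
          (d : ℕ) (hd : 2 * p + d = 2 * n) (p' q' : ℕ) (b : complexBetti X d),
          ¬ (p + p' = n ∧ p + q' = n) → A.pullback d b ∈ A.hodgePQ d p' q' →
          ∃ (η : complexBetti X d) (K t₀ : ℝ), 0 < t₀ ∧
            ∀ (t : ℝ) (S Sg : Set A.carrier) (γ : complexBetti X (2 * p)), |t| ≤ t₀ →
              IsNearlyHolomorphicCycleSupport g.toRiemannianMetric p t S Sg →
              singularCohomology.map ℂ ℂ
                (⟨Subtype.val, continuous_subtype_val⟩ : C({x : A.carrier // x ∉ S}, A.carrier))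
                (2 * p) (A.pullback (2 * p) γ) = 0 →
              ‖cupPairing (μ hX) hd γ b‖ ≤ K * |t| * ‖cupPairing (μ hX) hd γ η‖ :=
  Iff.rfl

end Summit.HodgeConjecture.HodgeConjecture.Theorems.HolomorphicityRate

end
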